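import Literature.NumberTheory.EllipticCurves.IsogenySelmerGroupsComposite
import Literature.NumberTheory.EllipticCurves.ShaIsogenyProofs
import Literature.NumberTheory.EllipticCurves.IsogenyDualProofs
import Literature.NumberTheory.EllipticCurves.SelmerCorankProofs
import HarnessLib

/-!
# Bhargava–Klagsbrun–Lemke Oliver–Shnidman 2019, Lemma 9.1 — discharge of
# `BhargavaKlagsbrunLemkeOliverShnidman2019.lemma91_selmerGroup_exact`

Topic `NumberTheory/EllipticCurves`; THEOREMS ONLY (no definition, no named fact, no instance; net
debt −1). This file proves the named fact `lemma91_selmerGroup_exact` of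
`IsogenySelmerGroupsComposite.lean` — Bhargava–Klagsbrun–Lemke Oliver–Shnidman, Duke Math. J. **168**
(2019) = arXiv:1709.09790, **Lemma 9.1** (held text `paper:arxiv-1709.09790`, chunk p0014 L5–L16):
"Let `φ₁ : A₁ → A₂` and `φ₂ : A₂ → A₃` be isogenies of abelian varieties and set `ψ = φ₂ ∘ φ₁`. Then
there is an exact sequence `Sel_{φ₁}(A₁) → Sel_ψ(A₁) → Sel_{φ₂}(A₂)`. *Proof.* In fact, a standard
diagram chase yields the exact sequence (9.1)
`0 → A₂(F)[φ₂]/φ₁(A₁(F)[ψ]) → Sel_{φ₁}(A₁) → Sel_ψ(A₁) → Sel_{φ₂}(A₂) → Ш(A₂)[φ₂]/φ₁(Ш(A₁)[ψ]) → 0`"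
— in the transcription of that file (elliptic curves `E₁, E₂, E₃` over a number field `K`, maps
`ι = galH1KerMapOfLe φ₁ ψ` along `E₁[φ₁] ⊆ E₁[ψ]` and `π = galH1KerMapComp φ₁ φ₂ ψ` along
`φ₁ : E₁[ψ] → E₂[φ₂]`; clauses (a) `ι(Sel_{φ₁}) ⊆ Sel_ψ`, (b) `π(Sel_ψ) ⊆ Sel_{φ₂}`, (c) exactness at
`Sel_ψ`, (d) the kernel of `ι` on `Sel_{φ₁}` is finite of order `≤ #E₂(K)[φ₂]`).

## The road (the printed "standard diagram chase", done on continuous crossed homomorphisms)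

No long exact cohomology sequence is invoked as such; every step is the tree's `H¹`-cocycle calculus
(`Literature.NumberTheory.GaloisRepresentations.oneCocycleClass`, file `ContinuousH1`; the
push/lift/coboundary toolkit of `SelmerCorankProofs`; functoriality `resH1Hom_comp` of
`SubgroupSelmer`), applied to the short exact sequence of finite discrete `Γ_K`-modules
`0 → E₁[φ₁] → E₁[ψ] → E₂[φ₂] → 0` (exact on the right because an isogeny of elliptic curves is onto
`K̄`-points, the tree's THEOREM `WeierstrassCurve.Isogeny.surjective`, file `IsogenyDualProofs`).

* §1 The two maps of the lemma ARE the tree's `resH1Hom` for the compatible pairs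
  `(id_{Γ_K}, E₁[φ₁] ↪ E₁[ψ])`, `(id_{Γ_K}, φ₁|)` (`rfl`), and `π ∘ ι = 0` (`φ₁` kills `E₁[φ₁]`).
* §2 Local conditions. (a) and the Selmer half of (c): the local restriction of `ι b` at a
  `K`-field `E` IS the local restriction of `b` — one `resH1Hom_comp` (the pair
  `(Γ_E → Γ_K, E₁[ψ] → E₁(K̄_E))` composed with `(id, incl)` is `(Γ_E → Γ_K, E₁[φ₁] → E₁(K̄_E))`).
  (b): the square `E₁[ψ] → E₂[φ₂]`, `E₁(K̄_E) → E₂(K̄_E)` commutes for the LOCAL POINTS MAP of `φ₁`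
  (the tree's THEOREM `Isogeny.localPointsMap_pointsMap` / `localPointsMap_smul`, file
  `ShaIsogenyProofs`, i.e. the base change of the isogeny, file `IsogenyBaseChange`), exactly as in
  `Literature.NumberTheory.EllipticCurves.galH1Map_mem_localRestrictionKer` (file `ShaIsogeny`).
* §3 Exactness at `H¹(K, E₁[ψ])`: if `π[a] = 0` then `φ₁ ∘ a = δm` for some `m ∈ E₂[φ₂]`
  (`oneCocycleClass_eq_zero_iff`); lift `m = φ₁ P` (`Isogeny.surjective`), so `P ∈ E₁[ψ]`, and
  `a − δP` is a continuous crossed homomorphism with values in `E₁[φ₁]` (`contOneCocycles.lift`)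
  whose image under `ι` is `[a] − [δP] = [a]`.
* §4 The first term of (9.1): if `ι[a] = 0` then `a = δP` with `P ∈ E₁[ψ]`, `Q := φ₁ P` is a
  `Γ_K`-fixed point of `E₂[φ₂]`, and `[a]` is the class of the connecting cocycle
  `σ ↦ σ P_Q − P_Q` of ANY chosen `φ₁`-lift `P_Q` of `Q` (two lifts differ by an element of
  `E₁[φ₁]`, i.e. by a coboundary there). Hence the kernel of `ι` is contained in the image of a map
  from the `Γ_K`-fixed points of `E₂[φ₂]`, a finite set of cardinality `Isogeny.ratKerCard φ₂`, which
  gives clause (d) (finiteness and the bound `ncard ≤ #E₂(K)[φ₂]`).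
* §5 Assembly: `lemma91_selmerGroup_exact_holds`.
* §6 Unconditional consequences (the statement file's `h91`-theorems fed `_holds`):
  `Isogeny.finite_selmerGroup` (Silverman X.4.2 (b) for every isogeny Selmer group over a number
  field), `Isogeny.natCard_selmerGroup_le_mul`, `Isogeny.natCard_selmerGroup_three_le` (BES Prop. 42 (i)).

## Main statements

* `WeierstrassCurve.Isogeny.mem_selmerLocalKer_iff_galH1KerMapOfLe_mem` (local condition of `b`
  vs `ι b`), `WeierstrassCurve.Isogeny.galH1KerMapComp_mem_selmerLocalKer` (`π` respects local
  conditions), `WeierstrassCurve.Isogeny.galH1KerMapComp_galH1KerMapOfLe` (`π ∘ ι = 0`),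
  `WeierstrassCurve.Isogeny.exists_galH1KerMapOfLe_eq_of_galH1KerMapComp_eq_zero` (exactness at
  `H¹(K, E₁[ψ])`),
  `WeierstrassCurve.Isogeny.finite_and_ncard_le_ratKerCard_of_galH1KerMapOfLe_eq_zero` (`ker ι` is
  finite of order `≤ #E₂(K)[φ₂]`).
* `Literature.NumberTheory.EllipticCurves.BhargavaKlagsbrunLemkeOliverShnidman2019.lemma91_selmerGroup_exact_holds`.

## References

* [BhargavaKlagsbrunLemkeOliverShnidman2019] M. Bhargava, Z. Klagsbrun, R. J. Lemke Oliver,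
  A. Shnidman, *3-isogeny Selmer groups and ranks of abelian varieties in quadratic twist families
  over a number field*, Duke Math. J. 168 (2019) 2951–2989 = arXiv:1709.09790, §9 Lemma 9.1 and
  display (9.1) (chunk p0014 L5–L16).
* [SerreGaloisCohomology1997] J.-P. Serre, *Galois Cohomology* (1997), I.§2.2 (cochains, cocycles),
  I.§2.4 (compatible pairs, functoriality), II.§1.1 (discrete `Γ_K`-modules).
* [SilvermanAEC2009] J. H. Silverman, *The Arithmetic of Elliptic Curves*, 2nd ed., X.§4
  (Thm. X.4.2: the `φ`-Selmer group, (b) its finiteness; the sequence `0 → E[φ] → E → E' → 0`),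
  III.6.1 (a) (dual isogeny), Appendix B.§1–2.
* [BhargavaElkiesShnidman2019] M. Bhargava, N. Elkies, A. Shnidman, J. Lond. Math. Soc. (2) 101
  (2020) 299–327 = arXiv:1610.05759, Prop. 42 (i) (chunk p0017 L9–L21).

## Design notes

* The `Γ_K`-module structure on a kernel `E[φ] = φ.toAddMonoidHom.ker` is the statement file's
  `Isogeny.kerAction` (an `abbrev`, not an instance, and not made one here either): it is supplied
  by `letI := φ.kerAction` inside each statement and proof, exactly as in the statement file, so
  that everything elaborates against the same structure as `galH1Ker`, `selmerLocalKer`,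
  `galH1KerMapOfLe`, `galH1KerMapComp` (checked by the `rfl` bridges of §1).
* Universe-polymorphic in `K : Type u`; the fact itself quantifies over `K : Type`.
* `noncomputable section`, `open scoped Classical`; no `def`, no `instance`, no new notation.
-/

noncomputable section

open scoped Classical NumberField
open WeierstrassCurve Literature.NumberTheory.EllipticCurves
open Literature.NumberTheory.GaloisRepresentations

universe u

namespace WeierstrassCurve.Isogeny

variable {K : Type u} [Field K] {W₁ W₂ W₃ : WeierstrassCurve K}

/-! ## §1 The two maps of Lemma 9.1 as compatible-pair maps; `π ∘ ι = 0` -/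

/-- The first map `ι : H¹(K, E₁[φ₁]) → H¹(K, E₁[ψ])` of Lemma 9.1 (`galH1KerMapOfLe`) is the tree's
`resH1Hom` for the compatible pair `(id_{Γ_K}, E₁[φ₁] ↪ E₁[ψ])` (definitional).
[cite: BhargavaKlagsbrunLemkeOliverShnidman2019, Lemma 9.1 (chunk p0014 L5–L10)] -/
theorem galH1KerMapOfLe_eq_resH1Hom (φ₁ : Isogeny W₁ W₂) (ψ : Isogeny W₁ W₃)
    (hle : φ₁.toAddMonoidHom.ker ≤ ψ.toAddMonoidHom.ker) :
    letI := φ₁.kerAction; letI := ψ.kerAction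
    galH1KerMapOfLe φ₁ ψ hle =
      resH1Hom (ContinuousMonoidHom.id (Field.absoluteGaloisGroup K))
        (AddSubgroup.inclusion hle) (fun _ _ ↦ rfl) :=
  rfl

/-- The second map `π : H¹(K, E₁[ψ]) → H¹(K, E₂[φ₂])` of Lemma 9.1 (`galH1KerMapComp`) is the
tree's `resH1Hom` for the compatible pair `(id_{Γ_K}, φ₁ : E₁[ψ] → E₂[φ₂])` (definitional).
[cite: BhargavaKlagsbrunLemkeOliverShnidman2019, Lemma 9.1 (chunk p0014 L5–L10)] -/
theorem galH1KerMapComp_eq_resH1Hom (φ₁ : Isogeny W₁ W₂) (φ₂ : Isogeny W₂ W₃)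
    (ψ : Isogeny W₁ W₃) (h : ∀ P, φ₂ (φ₁ P) = ψ P) :
    letI := ψ.kerAction; letI := φ₂.kerAction
    galH1KerMapComp φ₁ φ₂ ψ h =
      resH1Hom (ContinuousMonoidHom.id (Field.absoluteGaloisGroup K))
        (kerMapComp φ₁ φ₂ ψ h) (fun σ P ↦ Subtype.ext (φ₁.map_smul σ (P : W₁.geomPoints))) :=
  rfl

/-- The kernel-level map of Lemma 9.1 on geometric points: `(φ₁| P : E₂(K̄)) = φ₁ P`.
[cite: BhargavaKlagsbrunLemkeOliverShnidman2019, Lemma 9.1 (chunk p0014 L5–L10)] -/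
theorem coe_kerMapComp_apply (φ₁ : Isogeny W₁ W₂) (φ₂ : Isogeny W₂ W₃) (ψ : Isogeny W₁ W₃)
    (h : ∀ P, φ₂ (φ₁ P) = ψ P) (x : ψ.toAddMonoidHom.ker) :
    ((kerMapComp φ₁ φ₂ ψ h x : φ₂.toAddMonoidHom.ker) : W₂.geomPoints) = φ₁ (x : W₁.geomPoints) :=
  rfl

/-- `φ₁| ∘ (E₁[φ₁] ↪ E₁[ψ]) = 0`: the composite of the two kernel-level maps of Lemma 9.1 vanishes.
[cite: BhargavaKlagsbrunLemkeOliverShnidman2019, Lemma 9.1 (chunk p0014 L5–L10)] -/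
theorem kerMapComp_inclusion (φ₁ : Isogeny W₁ W₂) (φ₂ : Isogeny W₂ W₃) (ψ : Isogeny W₁ W₃)
    (h : ∀ P, φ₂ (φ₁ P) = ψ P) (x : φ₁.toAddMonoidHom.ker) :
    kerMapComp φ₁ φ₂ ψ h (AddSubgroup.inclusion (ker_le_ker_of_comp φ₁ φ₂ ψ h) x) = 0 := by
  apply Subtype.ext
  rw [coe_kerMapComp_apply, AddSubgroup.coe_inclusion, ZeroMemClass.coe_zero]
  have hx := x.2
  rw [AddMonoidHom.mem_ker, coe_toAddMonoidHom] at hx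
  exact hx

/-- **`π ∘ ι = 0`** on `H¹(K, E₁[φ₁])` (the maps of Lemma 9.1): computed on continuous crossed
homomorphisms, `π (ι [a]) = [φ₁ ∘ a] = [0]` since `a` takes values in `E₁[φ₁] = ker φ₁`.
[cite: BhargavaKlagsbrunLemkeOliverShnidman2019, Lemma 9.1 with display (9.1) (chunk p0014 L5–L16)] -/
theorem galH1KerMapComp_galH1KerMapOfLe (φ₁ : Isogeny W₁ W₂) (φ₂ : Isogeny W₂ W₃)
    (ψ : Isogeny W₁ W₃) (h : ∀ P, φ₂ (φ₁ P) = ψ P) (b : φ₁.galH1Ker) :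
    galH1KerMapComp φ₁ φ₂ ψ h (galH1KerMapOfLe φ₁ ψ (ker_le_ker_of_comp φ₁ φ₂ ψ h) b) = 0 := by
  letI := φ₁.kerAction; letI := ψ.kerAction; letI := φ₂.kerAction
  obtain ⟨a, rfl⟩ := oneCocycleClass_surjective _ b
  rw [galH1KerMapOfLe_eq_resH1Hom, galH1KerMapComp_eq_resH1Hom, resH1Hom_id_oneCocycleClass,
    resH1Hom_id_oneCocycleClass]
  have h0 : contOneCocycles.push (kerMapComp φ₁ φ₂ ψ h)
      (fun σ P ↦ Subtype.ext (φ₁.map_smul σ (P : W₁.geomPoints)))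
      (contOneCocycles.push (AddSubgroup.inclusion (ker_le_ker_of_comp φ₁ φ₂ ψ h))
        (fun _ _ ↦ rfl) a) = 0 := by
    apply Subtype.ext
    ext σ
    rw [contOneCocycles.push_apply, contOneCocycles.push_apply, kerMapComp_inclusion]
    rfl
  rw [h0]
  exact oneCocycleClass_zero _

/-! ## §2 Local conditions -/

section Local

variable (E : Type u) [Field E] [Algebra K E]

/-- Membership in the local kernel `selmerLocalKer E φ` (BKLOS §7: "the classes locally in the kernel
of `H¹(G_{F_v}, A[φ]) → H¹(G_{F_v}, A)`") is the vanishing of the tree's `resH1Hom` for the compatible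
pair `(Γ_E → Γ_K, E[φ] ↪ E(K̄) → E(K̄_E))` (definitional: `resKer = ker resH1Hom`).
[cite: BhargavaKlagsbrunLemkeOliverShnidman2019, §7 (chunk p0011 L7–L9)] -/
theorem mem_selmerLocalKer_iff (φ : Isogeny W₁ W₂) (c : φ.galH1Ker) :
    letI := φ.kerAction
    c ∈ φ.selmerLocalKer E ↔
      resH1Hom (resGal (K := K) E) ((pointsMap W₁ E).comp φ.toAddMonoidHom.ker.subtype)
        (fun σ P ↦ pointsMap_smul W₁ E σ (P : W₁.geomPoints)) c = 0 :=
  Iff.rfl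

/-- **The local restriction of `ι b` is the local restriction of `b`.** The compatible pair
`(Γ_E → Γ_K, E₁[ψ] → E₁(K̄_E))` composed with `(id_{Γ_K}, E₁[φ₁] ↪ E₁[ψ])` is the pair
`(Γ_E → Γ_K, E₁[φ₁] → E₁(K̄_E))`, so by functoriality of `H¹` in compatible pairs
(`resH1Hom_comp`) the two local restrictions agree.
[cite: SerreGaloisCohomology1997, I.§2.4 (compatible pairs, functoriality)] -/
theorem resH1Hom_galH1KerMapOfLe (φ₁ : Isogeny W₁ W₂) (ψ : Isogeny W₁ W₃)
    (hle : φ₁.toAddMonoidHom.ker ≤ ψ.toAddMonoidHom.ker) (b : φ₁.galH1Ker) :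
    letI := φ₁.kerAction; letI := ψ.kerAction
    resH1Hom (resGal (K := K) E) ((pointsMap W₁ E).comp ψ.toAddMonoidHom.ker.subtype)
        (fun σ P ↦ pointsMap_smul W₁ E σ (P : W₁.geomPoints)) (galH1KerMapOfLe φ₁ ψ hle b) =
      resH1Hom (resGal (K := K) E) ((pointsMap W₁ E).comp φ₁.toAddMonoidHom.ker.subtype)
        (fun σ P ↦ pointsMap_smul W₁ E σ (P : W₁.geomPoints)) b := by
  letI := φ₁.kerAction; letI := ψ.kerAction
  have key : (resH1Hom (resGal (K := K) E) ((pointsMap W₁ E).comp ψ.toAddMonoidHom.ker.subtype)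
        (fun σ P ↦ pointsMap_smul W₁ E σ (P : W₁.geomPoints))).comp (galH1KerMapOfLe φ₁ ψ hle) =
      resH1Hom (resGal (K := K) E) ((pointsMap W₁ E).comp φ₁.toAddMonoidHom.ker.subtype)
        (fun σ P ↦ pointsMap_smul W₁ E σ (P : W₁.geomPoints)) := by
    rw [galH1KerMapOfLe_eq_resH1Hom, resH1Hom_comp]
    exact resH1Hom_congr (by ext; rfl) (by ext; rfl) _ _
  exact congrArg (fun F ↦ F b) key

/-- **`b ∈ E₁[φ₁]`-local kernel at `E` iff `ι b ∈ E₁[ψ]`-local kernel at `E`** (both are the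
vanishing of the same class in `H¹(E, E₁(K̄_E))`). This gives clause (a) of Lemma 9.1 and the Selmer
half of its exactness clause (c).
[cite: BhargavaKlagsbrunLemkeOliverShnidman2019, Lemma 9.1 with display (9.1) (chunk p0014 L5–L16)] -/
theorem mem_selmerLocalKer_iff_galH1KerMapOfLe_mem (φ₁ : Isogeny W₁ W₂) (ψ : Isogeny W₁ W₃)
    (hle : φ₁.toAddMonoidHom.ker ≤ ψ.toAddMonoidHom.ker) (b : φ₁.galH1Ker) :
    b ∈ φ₁.selmerLocalKer E ↔ galH1KerMapOfLe φ₁ ψ hle b ∈ ψ.selmerLocalKer E := by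
  letI := φ₁.kerAction; letI := ψ.kerAction
  rw [mem_selmerLocalKer_iff, mem_selmerLocalKer_iff, resH1Hom_galH1KerMapOfLe]

/-- **The local restriction of `π c` is `H¹(φ₁,E)` of the local restriction of `c`**, where
`φ₁,E : E₁(K̄_E) → E₂(K̄_E)` is the local points map of the isogeny `φ₁` (its base change,
`Isogeny.localPointsMap`): the square of compatible pairs `(Γ_E → Γ_K, E₁[ψ] → E₁(K̄_E))`,
`(id_{Γ_K}, φ₁|)`, `(id_{Γ_E}, φ₁,E)`, `(Γ_E → Γ_K, E₂[φ₂] → E₂(K̄_E))` commutes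
(`Isogeny.localPointsMap_pointsMap`), so the maps on `H¹` do (`resH1Hom_comp`) — the argument of
`Literature.NumberTheory.EllipticCurves.galH1Map_mem_localRestrictionKer` on the kernels.
[cite: SerreGaloisCohomology1997, I.§2.4 (compatible pairs, functoriality)] -/
theorem resH1Hom_galH1KerMapComp (φ₁ : Isogeny W₁ W₂) (φ₂ : Isogeny W₂ W₃) (ψ : Isogeny W₁ W₃)
    (h : ∀ P, φ₂ (φ₁ P) = ψ P) (c : ψ.galH1Ker) :
    letI := ψ.kerAction; letI := φ₂.kerAction
    resH1Hom (resGal (K := K) E) ((pointsMap W₂ E).comp φ₂.toAddMonoidHom.ker.subtype)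
        (fun σ P ↦ pointsMap_smul W₂ E σ (P : W₂.geomPoints)) (galH1KerMapComp φ₁ φ₂ ψ h c) =
      resH1Hom (ContinuousMonoidHom.id (Field.absoluteGaloisGroup E)) (φ₁.localPointsMap E)
          (φ₁.localPointsMap_smul E)
        (resH1Hom (resGal (K := K) E) ((pointsMap W₁ E).comp ψ.toAddMonoidHom.ker.subtype)
          (fun σ P ↦ pointsMap_smul W₁ E σ (P : W₁.geomPoints)) c) := by
  letI := ψ.kerAction; letI := φ₂.kerAction
  have key : (resH1Hom (resGal (K := K) E) ((pointsMap W₂ E).comp φ₂.toAddMonoidHom.ker.subtype)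
        (fun σ P ↦ pointsMap_smul W₂ E σ (P : W₂.geomPoints))).comp (galH1KerMapComp φ₁ φ₂ ψ h) =
      (resH1Hom (ContinuousMonoidHom.id (Field.absoluteGaloisGroup E)) (φ₁.localPointsMap E)
          (φ₁.localPointsMap_smul E)).comp
        (resH1Hom (resGal (K := K) E) ((pointsMap W₁ E).comp ψ.toAddMonoidHom.ker.subtype)
          (fun σ P ↦ pointsMap_smul W₁ E σ (P : W₁.geomPoints))) := by
    rw [galH1KerMapComp_eq_resH1Hom, resH1Hom_comp, resH1Hom_comp]
    exact resH1Hom_congr (by ext; rfl)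
      (by ext P; exact (φ₁.localPointsMap_pointsMap E (P : W₁.geomPoints)).symm) _ _
  exact DFunLike.congr_fun key c

/-- **`π` respects the local conditions** (clause (b) of Lemma 9.1 at one `K`-field `E`): if `c`
dies in `H¹(E, E₁(K̄_E))` then `π c` dies in `H¹(E, E₂(K̄_E))`.
[cite: BhargavaKlagsbrunLemkeOliverShnidman2019, Lemma 9.1 with display (9.1) (chunk p0014 L5–L16)] -/
theorem galH1KerMapComp_mem_selmerLocalKer (φ₁ : Isogeny W₁ W₂) (φ₂ : Isogeny W₂ W₃)
    (ψ : Isogeny W₁ W₃) (h : ∀ P, φ₂ (φ₁ P) = ψ P) {c : ψ.galH1Ker}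
    (hc : c ∈ ψ.selmerLocalKer E) : galH1KerMapComp φ₁ φ₂ ψ h c ∈ φ₂.selmerLocalKer E := by
  letI := ψ.kerAction; letI := φ₂.kerAction
  rw [mem_selmerLocalKer_iff] at hc ⊢
  rw [resH1Hom_galH1KerMapComp, hc, map_zero]

end Local

/-! ## §3 Exactness at `H¹(K, E₁[ψ])` -/

/-- The orbit map `σ ↦ σ • P` of a point of a kernel `E[φ] ⊆ E(K̄)` is continuous (`E(K̄)` is a
discrete `Γ_K`-module: `WeierstrassCurve.continuous_smul_geomPoints`).
[cite: SerreGaloisCohomology1997, II.§1.1 (discrete Γ_K-modules)] -/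
theorem continuous_smul_ker (φ : Isogeny W₁ W₂) (P : φ.toAddMonoidHom.ker) :
    letI := φ.kerAction
    Continuous fun σ : Field.absoluteGaloisGroup K ↦ σ • P :=
  letI := φ.kerAction
  continuous_of_injective_comp (ι := ((↑) : φ.toAddMonoidHom.ker → W₁.geomPoints))
    Subtype.val_injective (W₁.continuous_smul_geomPoints (P : W₁.geomPoints))

section Exact

variable [W₁.IsElliptic] [W₂.IsElliptic]

/-- **Exactness of `H¹(K, E₁[φ₁]) → H¹(K, E₁[ψ]) → H¹(K, E₂[φ₂])` at the middle term** (the piece of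
the long exact cohomology sequence of `0 → E₁[φ₁] → E₁[ψ] → E₂[φ₂] → 0` behind display (9.1)), on
continuous crossed homomorphisms: if `π [a] = 0` then `φ₁ ∘ a = δm` is the coboundary of some
`m ∈ E₂[φ₂]`; `φ₁` being onto `E₂(K̄)` (`Isogeny.surjective`, elliptic curves), `m = φ₁ P` with
`P ∈ E₁[ψ]` (`ψ P = φ₂ (φ₁ P) = φ₂ m = O`), and `a − δP` takes values in `ker φ₁ = E₁[φ₁]`; its class
`b` has `ι b = [a] − [δP] = [a]`.
[cite: BhargavaKlagsbrunLemkeOliverShnidman2019, Lemma 9.1 with display (9.1) (chunk p0014 L5–L16)] -/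
theorem exists_galH1KerMapOfLe_eq_of_galH1KerMapComp_eq_zero (φ₁ : Isogeny W₁ W₂)
    (φ₂ : Isogeny W₂ W₃) (ψ : Isogeny W₁ W₃) (h : ∀ P, φ₂ (φ₁ P) = ψ P) {c : ψ.galH1Ker}
    (hc : galH1KerMapComp φ₁ φ₂ ψ h c = 0) :
    ∃ b : φ₁.galH1Ker, galH1KerMapOfLe φ₁ ψ (ker_le_ker_of_comp φ₁ φ₂ ψ h) b = c := by
  letI := φ₁.kerAction; letI := ψ.kerAction; letI := φ₂.kerAction
  obtain ⟨a, rfl⟩ := oneCocycleClass_surjective _ c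
  rw [galH1KerMapComp_eq_resH1Hom, resH1Hom_id_oneCocycleClass, oneCocycleClass_eq_zero_iff] at hc
  obtain ⟨v, hv⟩ := hc
  -- `hv g : φ₁ (a g) = g • v - v` in `E₂[φ₂]`; lift `v = φ₁ P` with `P ∈ E₁[ψ]` (`φ₁` is onto).
  obtain ⟨P, hP⟩ := φ₁.surjective (v : W₂.geomPoints)
  have hPψ : P ∈ ψ.toAddMonoidHom.ker := by
    have hv2 := v.2
    rw [AddMonoidHom.mem_ker, coe_toAddMonoidHom] at hv2 ⊢
    rw [← h, hP, hv2]
  set Pψ : ψ.toAddMonoidHom.ker := ⟨P, hPψ⟩ with hPψ_def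
  set δ := cobCocycle (G := Field.absoluteGaloisGroup K) Pψ (continuous_smul_ker ψ Pψ) with hδ
  have hg : ∀ g, φ₁ ((a.1 g : ψ.toAddMonoidHom.ker) : W₁.geomPoints) =
      g • (v : W₂.geomPoints) - (v : W₂.geomPoints) := by
    intro g
    have h1 := hv g
    rw [contOneCocycles.push_apply, discreteTopRep_ρ_apply] at h1
    have h2 := congrArg Subtype.val h1
    rw [coe_kerMapComp_apply, AddSubgroupClass.coe_sub, kerAction_coe_smul] at h2
    exact h2
  have hcoe : ∀ g, (((a - δ).1 g : ψ.toAddMonoidHom.ker) : W₁.geomPoints) =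
      ((a.1 g : ψ.toAddMonoidHom.ker) : W₁.geomPoints) - (g • P - P) := by
    intro g
    rw [Submodule.coe_sub, ContinuousMap.sub_apply, hδ, cobCocycle_apply, AddSubgroupClass.coe_sub,
      AddSubgroupClass.coe_sub, kerAction_coe_smul]
  -- the values of `a - δ` lie in `E₁[φ₁]`
  have hval : ∀ g, (((a - δ).1 g : ψ.toAddMonoidHom.ker) : W₁.geomPoints) ∈
      φ₁.toAddMonoidHom.ker := by
    intro g
    rw [AddMonoidHom.mem_ker, coe_toAddMonoidHom, hcoe, map_sub, map_sub, hg, φ₁.map_smul, hP,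
      sub_self]
  set a' := contOneCocycles.lift (G := Field.absoluteGaloisGroup K)
    (AddSubgroup.inclusion (ker_le_ker_of_comp φ₁ φ₂ ψ h)) (fun _ _ ↦ rfl)
    (AddSubgroup.inclusion_injective _) (a - δ)
    (fun g ↦ ⟨(((a - δ).1 g : ψ.toAddMonoidHom.ker) : W₁.geomPoints), hval g⟩)
    (fun g ↦ Subtype.ext rfl) with ha'
  refine ⟨oneCocycleClass _ a', ?_⟩
  rw [galH1KerMapOfLe_eq_resH1Hom, resH1Hom_id_oneCocycleClass, ha', contOneCocycles.push_lift,
    oneCocycleClass_sub, hδ, oneCocycleClass_cobCocycle, sub_zero]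

end Exact

/-! ## §4 The first term of (9.1): the kernel of `ι` comes from `E₂(K)[φ₂]` -/

section Connecting

variable [W₁.IsElliptic] [W₂.IsElliptic]

omit [W₁.IsElliptic] [W₂.IsElliptic] in
/-- The `Γ_K`-fixed (= `K`-rational) points of `E₂[φ₂]` form a finite set (inside the finite
kernel); its cardinality is `Isogeny.ratKerCard φ₂ = #E₂(K)[φ₂]`.
[cite: BhargavaKlagsbrunLemkeOliverShnidman2019, §9.1 (chunk p0014 L35–L37, the groups A[φ](F))] -/
theorem finite_ratKer (φ₂ : Isogeny W₂ W₃) :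
    Finite {P : W₂.geomPoints // φ₂ P = 0 ∧ ∀ σ : Field.absoluteGaloisGroup K, σ • P = P} :=
  Finite.of_injective (fun P ↦ (⟨P.1, by
      rw [AddMonoidHom.mem_ker, coe_toAddMonoidHom]; exact P.2.1⟩ : φ₂.toAddMonoidHom.ker))
    (fun P Q hPQ ↦ Subtype.ext (by simpa using Subtype.ext_iff.mp hPQ))

/-- **The connecting map `E₂(K)[φ₂] → H¹(K, E₁[φ₁])` covers the kernel of `ι`** (the first term
`A₂(F)[φ₂]/φ₁(A₁(F)[ψ]) ↪ Sel_{φ₁}(A₁)` of display (9.1), in the weak form the fact asks for): there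
is a map `δ♯` from the `Γ_K`-fixed points of `E₂[φ₂]` to `H¹(K, E₁[φ₁])` — `Q ↦ [σ ↦ σ P_Q − P_Q]`
for a chosen lift `φ₁ P_Q = Q` (the cocycle takes values in `E₁[φ₁]` because `Q` is fixed) — whose
range contains every class killed by `ι`: if `ι [a] = 0` then `a = δP` with `P ∈ E₁[ψ]`,
`Q := φ₁ P` is fixed (`σQ − Q = φ₁ (a σ) = O`), and `[a] = δ♯ Q` because `P_Q − P ∈ E₁[φ₁]`.
[cite: BhargavaKlagsbrunLemkeOliverShnidman2019, Lemma 9.1 with display (9.1) (chunk p0014 L5–L16)] -/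
theorem exists_connecting_range_of_galH1KerMapOfLe_eq_zero (φ₁ : Isogeny W₁ W₂)
    (φ₂ : Isogeny W₂ W₃) (ψ : Isogeny W₁ W₃) (h : ∀ P, φ₂ (φ₁ P) = ψ P) :
    ∃ δ : {P : W₂.geomPoints // φ₂ P = 0 ∧ ∀ σ : Field.absoluteGaloisGroup K, σ • P = P} →
        φ₁.galH1Ker,
      ∀ c : φ₁.galH1Ker, galH1KerMapOfLe φ₁ ψ (ker_le_ker_of_comp φ₁ φ₂ ψ h) c = 0 →
        c ∈ Set.range δ := by
  letI := φ₁.kerAction; letI := ψ.kerAction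
  -- a chosen `φ₁`-lift of every geometric point of `E₂`
  choose lift hlift using φ₁.surjective
  have hmem : ∀ (Q : {P : W₂.geomPoints // φ₂ P = 0 ∧ ∀ σ : Field.absoluteGaloisGroup K, σ • P = P})
      (σ : Field.absoluteGaloisGroup K), σ • lift Q.1 - lift Q.1 ∈ φ₁.toAddMonoidHom.ker := by
    intro Q σ
    rw [AddMonoidHom.mem_ker, coe_toAddMonoidHom, map_sub, φ₁.map_smul, hlift, Q.2.2 σ, sub_self]
  -- the connecting cocycle of `Q`, with values in `E₁[φ₁]`
  let conn : {P : W₂.geomPoints // φ₂ P = 0 ∧ ∀ σ : Field.absoluteGaloisGroup K, σ • P = P} →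
      contOneCocycles (discreteTopRep (Field.absoluteGaloisGroup K) φ₁.toAddMonoidHom.ker) :=
    fun Q ↦ contOneCocycles.lift (G := Field.absoluteGaloisGroup K) φ₁.toAddMonoidHom.ker.subtype
      (fun _ _ ↦ rfl) Subtype.val_injective
      (cobCocycle (G := Field.absoluteGaloisGroup K) (lift Q.1) (W₁.continuous_smul_geomPoints _))
      (fun σ ↦ ⟨σ • lift Q.1 - lift Q.1, hmem Q σ⟩) (fun _ ↦ rfl)
  have hconn : ∀ Q σ, (((conn Q).1 σ : φ₁.toAddMonoidHom.ker) : W₁.geomPoints) =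
      σ • lift Q.1 - lift Q.1 := fun _ _ ↦ rfl
  refine ⟨fun Q ↦ oneCocycleClass _ (conn Q), fun c hc ↦ ?_⟩
  obtain ⟨a, rfl⟩ := oneCocycleClass_surjective _ c
  rw [galH1KerMapOfLe_eq_resH1Hom, resH1Hom_id_oneCocycleClass, oneCocycleClass_eq_zero_iff] at hc
  obtain ⟨v, hv⟩ := hc
  -- `hv g : a g = g • v - v` in `E₁[ψ]` (`v ∈ E₁[ψ]`); put `Q := φ₁ v`.
  have hg : ∀ g, ((a.1 g : φ₁.toAddMonoidHom.ker) : W₁.geomPoints) =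
      g • (v : W₁.geomPoints) - (v : W₁.geomPoints) := by
    intro g
    have h1 := hv g
    rw [contOneCocycles.push_apply, discreteTopRep_ρ_apply] at h1
    have h2 := congrArg Subtype.val h1
    rw [AddSubgroup.coe_inclusion, AddSubgroupClass.coe_sub, kerAction_coe_smul] at h2
    exact h2
  have hQ0 : φ₂ (φ₁ (v : W₁.geomPoints)) = 0 := by
    have hv2 := v.2
    rw [AddMonoidHom.mem_ker, coe_toAddMonoidHom] at hv2
    rw [h, hv2]
  have hQfix : ∀ σ : Field.absoluteGaloisGroup K, σ • φ₁ (v : W₁.geomPoints) = φ₁ v := by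
    intro σ
    have ha := (a.1 σ).2
    rw [AddMonoidHom.mem_ker, coe_toAddMonoidHom, hg, map_sub, φ₁.map_smul, sub_eq_zero] at ha
    exact ha
  refine ⟨⟨φ₁ v, hQ0, hQfix⟩, ?_⟩
  change oneCocycleClass _ (conn ⟨φ₁ v, hQ0, hQfix⟩) = oneCocycleClass _ a
  rw [← sub_eq_zero, ← oneCocycleClass_sub, oneCocycleClass_eq_zero_iff]
  -- witness: `T = P_Q - v ∈ E₁[φ₁]`
  have hT : lift (φ₁ (v : W₁.geomPoints)) - v ∈ φ₁.toAddMonoidHom.ker := by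
    rw [AddMonoidHom.mem_ker, coe_toAddMonoidHom, map_sub, hlift, sub_self]
  refine ⟨⟨_, hT⟩, fun g ↦ Subtype.ext ?_⟩
  rw [Submodule.coe_sub, ContinuousMap.sub_apply, AddSubgroupClass.coe_sub, hconn, hg,
    discreteTopRep_ρ_apply, AddSubgroupClass.coe_sub, kerAction_coe_smul, smul_sub]
  exact sub_sub_sub_comm _ _ _ _

/-- **Clause (d) of the transcription of Lemma 9.1** (first term of (9.1), weak form): any set of
classes of `H¹(K, E₁[φ₁])` killed by `ι` is finite, of cardinality at most
`#E₂(K)[φ₂] = Isogeny.ratKerCard φ₂` (it lies in the range of the connecting map from the finite set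
of `Γ_K`-fixed points of `E₂[φ₂]`).
[cite: BhargavaKlagsbrunLemkeOliverShnidman2019, Lemma 9.1 with display (9.1) (chunk p0014 L5–L16)] -/
theorem finite_and_ncard_le_ratKerCard_of_galH1KerMapOfLe_eq_zero (φ₁ : Isogeny W₁ W₂)
    (φ₂ : Isogeny W₂ W₃) (ψ : Isogeny W₁ W₃) (h : ∀ P, φ₂ (φ₁ P) = ψ P) (S : Set φ₁.galH1Ker)
    (hS : ∀ c ∈ S, galH1KerMapOfLe φ₁ ψ (ker_le_ker_of_comp φ₁ φ₂ ψ h) c = 0) :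
    S.Finite ∧ S.ncard ≤ φ₂.ratKerCard := by
  haveI := finite_ratKer (K := K) φ₂
  obtain ⟨δ, hδ⟩ := exists_connecting_range_of_galH1KerMapOfLe_eq_zero φ₁ φ₂ ψ h
  have hsub : S ⊆ Set.range δ := fun c hc ↦ hδ c (hS c hc)
  refine ⟨(Set.finite_range _).subset hsub, ?_⟩
  calc S.ncard ≤ (Set.range δ).ncard := Set.ncard_le_ncard hsub (Set.finite_range _)
    _ = Nat.card (Set.range δ) := (Nat.card_coe_set_eq _).symm
    _ ≤ Nat.card {P : W₂.geomPoints // φ₂ P = 0 ∧ ∀ σ : Field.absoluteGaloisGroup K, σ • P = P} :=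
        Nat.card_le_card_of_surjective _ Set.rangeFactorization_surjective
    _ = φ₂.ratKerCard := rfl

end Connecting

end WeierstrassCurve.Isogeny

/-! ## §5 The discharge -/

namespace Literature.NumberTheory.EllipticCurves.BhargavaKlagsbrunLemkeOliverShnidman2019

open WeierstrassCurve WeierstrassCurve.Isogeny

/-- **Bhargava–Klagsbrun–Lemke Oliver–Shnidman 2019, Lemma 9.1 — PROVED** (the named fact
`lemma91_selmerGroup_exact` of `IsogenySelmerGroupsComposite.lean`, for elliptic curves over a
number field as transcribed there): for isogenies `φ₁ : E₁ → E₂`, `φ₂ : E₂ → E₃`, `ψ = φ₂ ∘ φ₁`,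
(a) `ι(Sel_{φ₁}(E₁)) ⊆ Sel_ψ(E₁)`; (b) `π(Sel_ψ(E₁)) ⊆ Sel_{φ₂}(E₂)`; (c) a class of `Sel_ψ(E₁)`
dies under `π` iff it comes from `Sel_{φ₁}(E₁)`; (d) the kernel of `ι` on `Sel_{φ₁}(E₁)` is finite
of order `≤ #E₂(K)[φ₂]`. Source: "Let `φ₁ : A₁ → A₂` and `φ₂ : A₂ → A₃` be isogenies of abelian
varieties and set `ψ = φ₂ ∘ φ₁`. Then there is an exact sequence
`Sel_{φ₁}(A₁) → Sel_ψ(A₁) → Sel_{φ₂}(A₂)`. *Proof.* In fact, a standard diagram chase yields the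
exact sequence (9.1) `0 → A₂(F)[φ₂]/φ₁(A₁(F)[ψ]) → Sel_{φ₁}(A₁) → Sel_ψ(A₁) → Sel_{φ₂}(A₂) → …`."
Proof here: §2 (local conditions: (a), (b), and "`b ∈ Sel_{φ₁} ⟺ ι b ∈ Sel_ψ`"), §1 (`π ∘ ι = 0`),
§3 (exactness of `H¹` at `E₁[ψ]`, via `Isogeny.surjective`), §4 (connecting map bound).
[cite: BhargavaKlagsbrunLemkeOliverShnidman2019, Lemma 9.1 with display (9.1) (chunk p0014 L5–L16)] -/
theorem lemma91_selmerGroup_exact_holds : lemma91_selmerGroup_exact := by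
  intro K _ _ W₁ W₂ W₃ _ _ _ φ₁ φ₂ ψ h
  have hle := ker_le_ker_of_comp φ₁ φ₂ ψ h
  refine ⟨?_, ?_, ?_, ?_⟩
  · -- (a) `ι(Sel_{φ₁}(E₁)) ⊆ Sel_ψ(E₁)`
    intro x hx
    obtain ⟨b, hb, rfl⟩ := AddSubgroup.mem_map.mp hx
    rw [Isogeny.mem_selmerGroup_iff] at hb ⊢
    exact ⟨fun v ↦ (mem_selmerLocalKer_iff_galH1KerMapOfLe_mem _ φ₁ ψ hle b).mp (hb.1 v),
      fun w ↦ (mem_selmerLocalKer_iff_galH1KerMapOfLe_mem _ φ₁ ψ hle b).mp (hb.2 w)⟩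
  · -- (b) `π(Sel_ψ(E₁)) ⊆ Sel_{φ₂}(E₂)`
    intro x hx
    obtain ⟨c, hc, rfl⟩ := AddSubgroup.mem_map.mp hx
    rw [Isogeny.mem_selmerGroup_iff] at hc ⊢
    exact ⟨fun v ↦ galH1KerMapComp_mem_selmerLocalKer _ φ₁ φ₂ ψ h (hc.1 v),
      fun w ↦ galH1KerMapComp_mem_selmerLocalKer _ φ₁ φ₂ ψ h (hc.2 w)⟩
  · -- (c) exactness at `Sel_ψ(E₁)`
    intro c hc
    constructor
    · intro h0
      obtain ⟨b, rfl⟩ := exists_galH1KerMapOfLe_eq_of_galH1KerMapComp_eq_zero φ₁ φ₂ ψ h h0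
      refine AddSubgroup.mem_map.mpr ⟨b, ?_, rfl⟩
      rw [Isogeny.mem_selmerGroup_iff] at hc ⊢
      exact ⟨fun v ↦ (mem_selmerLocalKer_iff_galH1KerMapOfLe_mem _ φ₁ ψ hle b).mpr (hc.1 v),
        fun w ↦ (mem_selmerLocalKer_iff_galH1KerMapOfLe_mem _ φ₁ ψ hle b).mpr (hc.2 w)⟩
    · intro hmem
      obtain ⟨b, -, rfl⟩ := AddSubgroup.mem_map.mp hmem
      exact galH1KerMapComp_galH1KerMapOfLe φ₁ φ₂ ψ h b
  · -- (d) `#ker(ι|Sel_{φ₁}) ≤ #E₂(K)[φ₂]`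
    exact finite_and_ncard_le_ratKerCard_of_galH1KerMapOfLe_eq_zero φ₁ φ₂ ψ h _ (fun c hc ↦ hc.2)

end Literature.NumberTheory.EllipticCurves.BhargavaKlagsbrunLemkeOliverShnidman2019

/-! ## §6 Unconditional consequences (the `h91`-theorems of the statement file, fed `_holds`) -/

namespace WeierstrassCurve.Isogeny

open Literature.NumberTheory.EllipticCurves.BhargavaKlagsbrunLemkeOliverShnidman2019

/-- **Every isogeny Selmer group of an elliptic curve over a number field is finite** (Silverman,
*AEC*, Thm. X.4.2 (b): "`S^{(φ)}(E/K)` is finite"): for an isogeny `φ : E → E'` of elliptic curves over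
a number field `K`, `Sel_φ(E/K)` is finite — the statement file's `finite_selmerGroup_of_lemma91`
(kernel of `Sel_φ(E) → Sel_{φ̂∘φ}(E) ≅ Sel^{(n)}(E)` finite by Lemma 9.1 (d), target finite by the tree's
`finite_selmerGroup_holds`) fed the theorem `lemma91_selmerGroup_exact_holds` and the dual isogeny
`φ̂ ∘ φ = [deg φ]` (`Isogeny.exists_dual_of_isElliptic`, Silverman III.6.1 (a)).
[cite: SilvermanAEC2009, X.§4 (Thm. X.4.2 (b))] -/
theorem finite_selmerGroup {K : Type} [Field K] [NumberField K] {W W' : WeierstrassCurve K}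
    [W.IsElliptic] [W'.IsElliptic] (φ : Isogeny W W') : Finite φ.selmerGroup := by
  obtain ⟨ψ, hψ⟩ := φ.exists_dual_of_isElliptic
  exact finite_selmerGroup_of_lemma91 lemma91_selmerGroup_exact_holds φ ψ
    (Int.natCast_ne_zero.mpr φ.degree_pos.ne') hψ

/-- **`#Sel_ψ(E₁) ≤ #Sel_{φ₁}(E₁) · #Sel_{φ₂}(E₂)` for `ψ = φ₂ ∘ φ₁`, unconditionally** (how BKLOS §9
and BES Prop. 42 (i) use Lemma 9.1): the statement file's `natCard_selmerGroup_le_mul_of_lemma91` fed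
`lemma91_selmerGroup_exact_holds`, the finiteness instances supplied by `finite_selmerGroup`.
[cite: BhargavaKlagsbrunLemkeOliverShnidman2019, §9 (chunk p0014 L18–L27, "by Lemma (lem:ranks-add)")] -/
theorem natCard_selmerGroup_le_mul {K : Type} [Field K] [NumberField K]
    {W₁ W₂ W₃ : WeierstrassCurve K} [W₁.IsElliptic] [W₂.IsElliptic] [W₃.IsElliptic]
    (φ₁ : Isogeny W₁ W₂) (φ₂ : Isogeny W₂ W₃) (ψ : Isogeny W₁ W₃) (h : ∀ P, φ₂ (φ₁ P) = ψ P) :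
    Nat.card ψ.selmerGroup ≤ Nat.card φ₁.selmerGroup * Nat.card φ₂.selmerGroup := by
  haveI := finite_selmerGroup φ₁
  haveI := finite_selmerGroup φ₂
  exact natCard_selmerGroup_le_mul_of_lemma91 lemma91_selmerGroup_exact_holds φ₁ φ₂ ψ h

/-- **Bhargava–Elkies–Shnidman 2020, Prop. 42 (i), second inequality, unconditionally**:
`#Sel^{(3)}(E/K) ≤ #Sel_φ(E) · #Sel_{φ̂}(E')` for a dual pair of `3`-isogenies (`φ̂ ∘ φ = [3]`,
`φ ∘ φ̂ = [3]`) — the statement file's `natCard_selmerGroup_three_le_of_lemma91` fed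
`lemma91_selmerGroup_exact_holds`.
[cite: BhargavaElkiesShnidman2019, Prop. 42 (i) (chunk p0017 L12, L17–L21)] -/
theorem natCard_selmerGroup_three_le {K : Type} [Field K] [NumberField K]
    {W W' : WeierstrassCurve K} [W.IsElliptic] [W'.IsElliptic] (φ : Isogeny W W') (ψ : Isogeny W' W)
    (hψφ : ∀ P, ψ (φ P) = (3 : ℤ) • P) (hφψ : ∀ Q, φ (ψ Q) = (3 : ℤ) • Q) :
    Nat.card (W.selmerGroup 3) ≤ Nat.card φ.selmerGroup * Nat.card ψ.selmerGroup :=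
  natCard_selmerGroup_three_le_of_lemma91 lemma91_selmerGroup_exact_holds φ ψ hψφ hφψ

end WeierstrassCurve.Isogeny
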